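import Summits.FinalStateConjecture.FinalStateConjecture.Theses.SpectralSurfaceGravity
import Summits.FinalStateConjecture.FinalStateConjecture.Theorems.SpectralSurfaceGravityAssemblyT2

/-!
# Route SpectralSurfaceGravity — the assembly item, closed by name; the rev-3 frame retired

This module used to carry only `SpectralSurfaceGravity.assembly_frame_proof`, the FRAME form of the
assembly item stmt-FinalStateConjecture-11041 of route `SpectralSurfaceGravity`
(`HorizonSubextremal → LinearRedShift → KerrCalibration → GenericRedShiftedSettling → MGHDExists →
FinalStateConjecture`): the five route-rev-3 item bodies INLINED VERBATIM as hypotheses and the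
summit statement `_root_.FinalStateConjecture` as conclusion (inlined so that the route file could
import the closing module without an import cycle; proof = antitone Christodoulou genericity, pure
logic).

The summit statement was re-typed on 2026-08-16 (T2, p126844: TAME Christodoulou genericity on one
fixed asymptotically flat end; settled clause enriched by `RaysStayInClosure`, honest radii in
`HasExhaustiveCharts`, `IsFutureOriented`); the route restated its four non-assembly items (rev 4,
stmt-FinalStateConjecture-17367/17369/17368/17370) and reopened the assembly item (same text, new
referents).  The rev-3 frame statement — OLD bodies as hypotheses, RE-TYPED summit as conclusion —
then stopped elaborating in its proof (full builds 2026-08-16T23:32Z, 2026-08-17T00:13Z: the old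
`GenericRedShiftedSettling` body supplies plain `IsChristodoulouGeneric` and the old settled clause,
not the tame genericity and the enriched clause the conclusion now demands) and no longer follows by
logic, while none of the old items is refuted as typed, so it has no proof either way; Theorems files
are append-only (a restatement under the same name bounced, p132294; so does a removal).  The
re-typed frame landed under a new name, `SpectralSurfaceGravity.assemblyT2_frame_proof`
(`Theorems/SpectralSurfaceGravityAssemblyT2.lean`, p132447: rev-4 bodies verbatim, no import of the
route module, so the route file may link it as `Assembly_holds`).

This module (2026-08-17) therefore
* closes the assembly item BY NAME: `SpectralSurfaceGravity.assembly_proof : Assembly` is the T2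
  frame theorem, whose type unfolds (`δ`/`ζ` only) to the route decl — this module imports the route
  module, so the route records the closure as `proved by … @ commit`;
* keeps the old name `SpectralSurfaceGravity.assembly_frame_proof` alive as a DEPRECATED ALIAS of the
  T2 frame theorem (append-only; its own rev-3 statement is withdrawn, see above).
-/

-- `Summit.<Summit>.<Problem>` is the mandated summit-side namespace (CONVENTIONS §2); for the
-- single-conjunct summit `FinalStateConjecture` the two coincide, so the duplicate is deliberate.
set_option linter.dupNamespace false

namespace Summit.FinalStateConjecture.FinalStateConjecture.Theorems

/-- **Assembly of route SpectralSurfaceGravity** (item stmt-FinalStateConjecture-11041, route rev 4):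
`HorizonSubextremal → LinearRedShift → KerrCalibration → GenericRedShiftedSettling → MGHDExists →
FinalStateConjecture`, stated against the route decl and proved by the landed T2 frame theorem
`SpectralSurfaceGravity.assemblyT2_frame_proof` (the five item bodies inlined verbatim there, so the
two types agree by unfolding the route's definitions).  Content of that proof: tame Christodoulou
genericity is monotone in the property; pointwise on admissible data `MGHDExists` gives the MGHD,
`GenericRedShiftedSettling` the complete null infinity and the red-shifted-collar decomposition of
every MGHD, and `HorizonSubextremal` turns the latter into the Statement's sub-extremal, rays-closed,
exhaustive, future-oriented clause, for the datum itself and along the one-ended tame family;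
`LinearRedShift` and `KerrCalibration` ride as idle hypotheses. [folklore] -/
theorem SpectralSurfaceGravity.assembly_proof :
    Summit.FinalStateConjecture.FinalStateConjecture.Theses.SpectralSurfaceGravity.Assembly :=
  SpectralSurfaceGravity.assemblyT2_frame_proof

/-- **Retired rev-3 assembly frame of route SpectralSurfaceGravity** (item
stmt-FinalStateConjecture-11041).  Its own statement (rev-3 item bodies inlined as hypotheses,
re-typed summit statement as conclusion) became unprovable by logic with the T2 statement revision of
2026-08-16 and is withdrawn; the name is kept (Theorems files are append-only) as a deprecated alias
of the re-typed frame `SpectralSurfaceGravity.assemblyT2_frame_proof`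
(`Theorems/SpectralSurfaceGravityAssemblyT2.lean`), whose type unfolds to the current route decl
`Summit.FinalStateConjecture.FinalStateConjecture.Theses.SpectralSurfaceGravity.Assembly`
(`SpectralSurfaceGravity.assembly_proof`). [folklore] -/
@[deprecated SpectralSurfaceGravity.assemblyT2_frame_proof (since := "2026-08-17")]
alias SpectralSurfaceGravity.assembly_frame_proof := SpectralSurfaceGravity.assemblyT2_frame_proof

end Summit.FinalStateConjecture.FinalStateConjecture.Theorems
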